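import Literature.Geometry.Lorentzian.KerrStarWaveOperator
import Literature.Analysis.SpecialFunctions.OblateSpheroidalWeakAngular
import HarnessLib

/-!
# The angular part of `ρ² □_g` on Kerr in the coordinates `(t*, r, θ, φ*)` paired with the oblate
# spheroidal harmonics (angular half of Carter's separation, DRSR Prop. 5.2.1)

Dafermos–Rodnianski–Shlapentokh-Rothman, arXiv:1402.7034, §5.2.3, Prop. 5.2.1: Carter's
separation of `□_g` is obtained by expanding in the oblate spheroidal harmonics
`S_{mℓ}(aω, cos θ)e^{imφ}` — eigenfunctions of `P(aω)` ((32)) — the angular part of `ρ² □_g`.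
The tree has the coordinate form of `ρ² □_g` in `(t*, r, θ, φ*)`
(`Kerr.blSigma_mul_coordWave_starChart`, whose `θ, φ`-part is
`∂_θ² F + cot θ ∂_θ F + sin⁻²θ ∂_φ² F`, `F = Φ ∘ κ_a`) and the harmonics as a Hilbert basis
`Ψ_q = oblateSphereBasis (2π) ν q` of `L²([-1,1] × 𝕋)` with the weak eigen-equation against all
`C²` polar test functions (`oblateSphere_weak_polar`). This file joins the two:

* `Kerr.starq t r θ φ` — the coordinate quadruple; the `θ`- and `φ`-coordinate lines
  (`starq_add_theta`, `starq_add_phi`), line derivatives of a function and of its coordinate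
  derivatives (`hasDerivAt_comp_starq_theta/phi`, `hasDerivAt_fderiv_comp_starq_theta/phi`);
  `2π`-periodicity of the chart in `φ` (`starChart_add_two_pi`) and its degeneration at the
  poles (`starChart_starq_of_sin_eq_zero`);
* `Kerr.flatBox Φ y = -∂₀²Φ + ∂₁²Φ + ∂₂²Φ + ∂₃²Φ` and the `M = 0` case of the coordinate form:
  `inverseMetric_zero_mass`, `divInverseMetric_zero_mass`;
* `Kerr.sphLaplacianStar a Φ q` — **the angular Laplacian `Δ̸_{(θ,φ*)} F` of `F = Φ ∘ κ_a`,
  as an everywhere-continuous function of `q`**: defined as `Σ·(flat □Φ)(κ q)` minus the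
  `t*, r`-parts of the coordinate form, it equals `∂₂∂₂F + cot θ ∂₂F + sin⁻²θ ∂₃∂₃F` wherever
  `sin θ ≠ 0`, `r > 0` (`sphLaplacianStar_eq`), and is continuous for `Φ ∈ C²`
  (`continuous_sphLaplacianStar`);
* `Kerr.inner_oblateSphereBasis_sphLaplacianStar` (**main**): for `Φ ∈ C²(ℝ⁴)`, `r > 0`, every
  real `ν` and every index `q`,
  `⟪Ψ_q, 𝓛(Δ̸F|_{t*,r})⟫ = -λ_q(ν) ⟪Ψ_q, 𝓛(F|_{t*,r})⟫ - ν² ⟪Ψ_q, x² · 𝓛(F|_{t*,r})⟫`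
  in `L²([-1,1] × 𝕋)`, `𝓛` the polar pull-back `polarLp (2π)` of the slice
  `(θ, φ) ↦ F(t*, r, θ, φ)`. Together with `x² = cos²θ = 1 - sin²θ` this expresses the pairing of
  the full `θ, φ`-dependent part of `ρ²□_g` on an `(ω, m)`-mode through `λ_{mℓ}(aω)`.

Proof of the main statement: the slice `g(θ, φ) = F(starq t r θ φ)` and `h = -Δ̸F|` satisfy the
hypotheses of `oblateSphere_weak_polar`: the `θ`- and `φ`-derivatives are line derivatives of
the `C²` function `F`, `2π`-periodicity comes from the chart, continuity of `h` from its
definition through the flat wave operator, and the relation `sin²θ·h = -sin θ ∂_θ(sin θ ∂_θ g)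
- ∂_φ² g` is `sphLaplacianStar_eq` off the poles and `∂_φ²g = 0` at the poles (the chart does not
depend on `φ` there).

## References

* M. Dafermos, I. Rodnianski, Y. Shlapentokh-Rothman, arXiv:1402.7034, §5.2.1 (32), §5.2.3
  Prop. 5.2.1 ("Carter's formal separation of the wave operator yields …").
  [DafermosRodnianskiShlapentokhrothman2014]
* S. Aretakis, JFA 263 (2012), §2.4 (the operator `ρ²□_g` in `(v, r, θ, φ*)`). [Aretakis2012]
-/

noncomputable section

open Real Set Filter MeasureTheory
open scoped Topology InnerProductSpace ComplexConjugate

namespace Literature.Geometry.Lorentzian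

namespace Kerr

open Literature.Analysis.SpecialFunctions Literature.Analysis.FunctionSpaces
  Literature.Analysis.Fourier

/-! ### Coordinate quadruples and coordinate lines -/

/-- The coordinate quadruple `q = (t*, r, θ, φ)` as a point of `E4`. [folklore] -/
def starq (t r θ φ : ℝ) : E4 := WithLp.toLp 2 ![t, r, θ, φ]

/-- Components. [folklore] -/
theorem starq_apply_zero (t r θ φ : ℝ) : starq t r θ φ 0 = t := by simp [starq]

/-- Components. [folklore] -/
theorem starq_apply_one (t r θ φ : ℝ) : starq t r θ φ 1 = r := by simp [starq]

/-- Components. [folklore] -/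
theorem starq_apply_two (t r θ φ : ℝ) : starq t r θ φ 2 = θ := by simp [starq]

/-- Components. [folklore] -/
theorem starq_apply_three (t r θ φ : ℝ) : starq t r θ φ 3 = φ := by simp [starq]

/-- The `θ`-coordinate line. [folklore] -/
theorem starq_add_theta (t r θ φ s : ℝ) :
    starq t r (θ + s) φ = starq t r θ φ + s • E4.basisVector 2 := by
  ext i
  rw [add_smul_basisVector_apply]
  fin_cases i <;> simp [starq]

/-- The `φ`-coordinate line. [folklore] -/
theorem starq_add_phi (t r θ φ s : ℝ) :
    starq t r θ (φ + s) = starq t r θ φ + s • E4.basisVector 3 := by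
  ext i
  rw [add_smul_basisVector_apply]
  fin_cases i <;> simp [starq]

/-- The `θ`-line has velocity `∂₂`. [folklore] -/
theorem hasDerivAt_starq_theta (t r θ φ : ℝ) :
    HasDerivAt (fun θ' : ℝ ↦ starq t r θ' φ) (E4.basisVector 2) θ := by
  have h : (fun θ' : ℝ ↦ starq t r θ' φ) = fun θ' ↦ starq t r 0 φ + θ' • E4.basisVector 2 := by
    funext θ'
    rw [← starq_add_theta, zero_add]
  rw [h]
  exact (((hasDerivAt_id θ).smul_const (E4.basisVector 2)).const_add _).congr_deriv (one_smul _ _)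

/-- The `φ`-line has velocity `∂₃`. [folklore] -/
theorem hasDerivAt_starq_phi (t r θ φ : ℝ) :
    HasDerivAt (fun φ' : ℝ ↦ starq t r θ φ') (E4.basisVector 3) φ := by
  have h : (fun φ' : ℝ ↦ starq t r θ φ') = fun φ' ↦ starq t r θ 0 + φ' • E4.basisVector 3 := by
    funext φ'
    rw [← starq_add_phi, zero_add]
  rw [h]
  exact (((hasDerivAt_id φ).smul_const (E4.basisVector 3)).const_add _).congr_deriv (one_smul _ _)

/-- `starq` is continuous in `(θ, φ)`. [folklore] -/
theorem continuous_starq (t r : ℝ) : Continuous fun p : ℝ × ℝ ↦ starq t r p.1 p.2 := by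
  have h : (fun p : ℝ × ℝ ↦ starq t r p.1 p.2) =
      fun p ↦ starq t r 0 0 + p.1 • E4.basisVector 2 + p.2 • E4.basisVector 3 := by
    funext p
    rw [← starq_add_theta, zero_add, ← starq_add_phi, zero_add]
  rw [h]
  fun_prop

section LineDerivatives

variable {F : E4 → ℝ}

/-- **Line derivative along `θ`**: `d/dθ F(starq t r θ φ) = ∂₂F`. [folklore] -/
theorem hasDerivAt_comp_starq_theta (t r θ φ : ℝ) (hF : DifferentiableAt ℝ F (starq t r θ φ)) :
    HasDerivAt (fun θ' ↦ F (starq t r θ' φ)) (fderiv ℝ F (starq t r θ φ) (E4.basisVector 2)) θ :=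
  hF.hasFDerivAt.comp_hasDerivAt θ (hasDerivAt_starq_theta t r θ φ)

/-- **Line derivative along `φ`**: `d/dφ F(starq t r θ φ) = ∂₃F`. [folklore] -/
theorem hasDerivAt_comp_starq_phi (t r θ φ : ℝ) (hF : DifferentiableAt ℝ F (starq t r θ φ)) :
    HasDerivAt (fun φ' ↦ F (starq t r θ φ')) (fderiv ℝ F (starq t r θ φ) (E4.basisVector 3)) φ :=
  hF.hasFDerivAt.comp_hasDerivAt φ (hasDerivAt_starq_phi t r θ φ)

/-- The coordinate derivative `q ↦ ∂_v F(q)` of a `C²` function is differentiable with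
derivative `u ↦ D²F(q)(u)(v)`. [folklore] -/
theorem hasFDerivAt_fderiv_apply (hF : ContDiff ℝ 2 F) (q v : E4) :
    HasFDerivAt (fun q ↦ fderiv ℝ F q v) ((fderiv ℝ (fderiv ℝ F) q).flip v) q := by
  have h1 : HasFDerivAt (fderiv ℝ F) (fderiv ℝ (fderiv ℝ F) q) q :=
    ((hF.fderiv_right (m := 1) (by norm_num)).differentiable one_ne_zero q).hasFDerivAt
  have h2 := (ContinuousLinearMap.apply ℝ ℝ v).hasFDerivAt.comp q h1
  refine h2.congr_fderiv ?_
  ext u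
  simp [ContinuousLinearMap.flip_apply]

/-- **Second line derivative along `θ`**: `d/dθ ∂₂F(starq t r θ φ) = ∂₂∂₂F`. [folklore] -/
theorem hasDerivAt_fderiv_comp_starq_theta (hF : ContDiff ℝ 2 F) (t r θ φ : ℝ) (v : E4) :
    HasDerivAt (fun θ' ↦ fderiv ℝ F (starq t r θ' φ) v)
      (fderiv ℝ (fderiv ℝ F) (starq t r θ φ) (E4.basisVector 2) v) θ := by
  have h := (hasFDerivAt_fderiv_apply hF (starq t r θ φ) v).comp_hasDerivAt θ
    (hasDerivAt_starq_theta t r θ φ)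
  exact h.congr_deriv (by rw [ContinuousLinearMap.flip_apply])

/-- **Second line derivative along `φ`**: `d/dφ ∂_vF(starq t r θ φ) = ∂₃∂_vF`. [folklore] -/
theorem hasDerivAt_fderiv_comp_starq_phi (hF : ContDiff ℝ 2 F) (t r θ φ : ℝ) (v : E4) :
    HasDerivAt (fun φ' ↦ fderiv ℝ F (starq t r θ φ') v)
      (fderiv ℝ (fderiv ℝ F) (starq t r θ φ) (E4.basisVector 3) v) φ := by
  have h := (hasFDerivAt_fderiv_apply hF (starq t r θ φ) v).comp_hasDerivAt φ
    (hasDerivAt_starq_phi t r θ φ)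
  exact h.congr_deriv (by rw [ContinuousLinearMap.flip_apply])

/-- Continuity of `(θ, φ) ↦ F(starq t r θ φ)`. [folklore] -/
theorem continuous_comp_starq (hF : Continuous F) (t r : ℝ) :
    Continuous (Function.uncurry fun θ φ ↦ F (starq t r θ φ)) :=
  hF.comp (continuous_starq t r)

/-- Continuity of `(θ, φ) ↦ ∂_vF(starq t r θ φ)` for `F ∈ C¹`. [folklore] -/
theorem continuous_fderiv_comp_starq {n : WithTop ℕ∞} (hF : ContDiff ℝ n F) (hn : n ≠ 0)
    (t r : ℝ) (v : E4) :
    Continuous (Function.uncurry fun θ φ ↦ fderiv ℝ F (starq t r θ φ) v) :=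
  ((ContinuousLinearMap.apply ℝ ℝ v).continuous.comp (hF.continuous_fderiv hn)).comp
    (continuous_starq t r)

/-- Continuity of `(θ, φ) ↦ ∂_u∂_vF(starq t r θ φ)` for `F ∈ C²`. [folklore] -/
theorem continuous_fderiv_fderiv_comp_starq (hF : ContDiff ℝ 2 F) (t r : ℝ) (u v : E4) :
    Continuous (Function.uncurry fun θ φ ↦ fderiv ℝ (fderiv ℝ F) (starq t r θ φ) u v) := by
  have h2 : Continuous (fderiv ℝ (fderiv ℝ F)) :=
    (hF.fderiv_right (m := 1) (by norm_num)).continuous_fderiv one_ne_zero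
  exact ((ContinuousLinearMap.apply ℝ ℝ v).continuous.comp
    (((ContinuousLinearMap.apply ℝ (E4 →L[ℝ] ℝ) u).continuous.comp h2))).comp (continuous_starq t r)

end LineDerivatives

/-! ### The chart: periodicity in `φ` and the poles -/

/-- **`κ_a` is `2π`-periodic in `φ`**: `κ(q + 2π ∂₃) = κ(q)`. [folklore] -/
theorem starChart_add_two_pi (a : ℝ) (q : E4) :
    starChart a (q + (2 * π) • E4.basisVector 3) = starChart a q := by
  have h0 : (q + (2 * π) • E4.basisVector 3) 0 = q 0 := by
    rw [add_smul_basisVector_apply, if_neg (by decide), add_zero]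
  have h1 : (q + (2 * π) • E4.basisVector 3) 1 = q 1 := by
    rw [add_smul_basisVector_apply, if_neg (by decide), add_zero]
  have h2 : (q + (2 * π) • E4.basisVector 3) 2 = q 2 := by
    rw [add_smul_basisVector_apply, if_neg (by decide), add_zero]
  have h3 : (q + (2 * π) • E4.basisVector 3) 3 = q 3 + 2 * π := by
    rw [add_smul_basisVector_apply, if_pos rfl]
  rw [starChart_eq_toLp, starChart_eq_toLp, h0, h1, h2, h3, cos_add_two_pi, sin_add_two_pi]

/-- The pull-back `F = Φ ∘ κ_a` is `2π`-periodic in `φ`. [folklore] -/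
theorem starPull_add_two_pi (a : ℝ) (Φ : E4 → ℝ) (q : E4) :
    starPull a Φ (q + (2 * π) • E4.basisVector 3) = starPull a Φ q := by
  rw [starPull_apply, starPull_apply, starChart_add_two_pi]

/-- So are its coordinate derivatives. [folklore] -/
theorem fderiv_starPull_add_two_pi (a : ℝ) (Φ : E4 → ℝ) (q : E4) :
    fderiv ℝ (starPull a Φ) (q + (2 * π) • E4.basisVector 3) = fderiv ℝ (starPull a Φ) q := by
  have h : starPull a Φ = fun q ↦ starPull a Φ (q + (2 * π) • E4.basisVector 3) :=
    funext fun q ↦ (starPull_add_two_pi a Φ q).symm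
  conv_rhs => rw [h]
  rw [fderiv_comp_add_right]

/-- **At the poles the chart does not depend on `φ`**: if `sin θ = 0` then
`κ(t, r, θ, φ) = κ(t, r, θ, 0)`. [folklore] -/
theorem starChart_starq_of_sin_eq_zero (a : ℝ) {t r θ : ℝ} (hθ : sin θ = 0) (φ : ℝ) :
    starChart a (starq t r θ φ) = starChart a (starq t r θ 0) := by
  rw [starChart_eq_toLp, starChart_eq_toLp]
  simp only [starq_apply_zero, starq_apply_one, starq_apply_two, starq_apply_three, hθ,
    mul_zero]

/-! ### The flat wave operator and the `M = 0` coordinate form -/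

/-- For `M = 0` the inverse Kerr–Schild metric is Minkowski. [folklore] -/
theorem inverseMetric_zero_mass (a : ℝ) (x : E4) (μ ν : Fin 4) :
    inverseMetric 0 a x μ ν = if μ = ν then (if μ = 0 then -1 else 1) else 0 := by
  rw [inverseMetric_apply]
  simp [scalarH]

/-- For `M = 0` the divergence of the inverse metric vanishes. [folklore] -/
theorem divInverseMetric_zero_mass (a : ℝ) (x : E4) (ν : Fin 4) : divInverseMetric 0 a x ν = 0 := by
  rw [divInverseMetric]
  refine Finset.sum_eq_zero fun μ _ ↦ ?_
  have h : (fun y ↦ inverseMetric 0 a y μ ν) = fun _ ↦ inverseMetric 0 a x μ ν := by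
    funext y
    rw [inverseMetric_zero_mass, inverseMetric_zero_mass]
  rw [h, fderiv_const_apply]
  rfl

/-- **The flat wave operator** `□_η Φ = -∂₀²Φ + ∂₁²Φ + ∂₂²Φ + ∂₃²Φ` in the Cartesian coordinates of
`E4`. [folklore] -/
def flatBox (Φ : E4 → ℝ) (y : E4) : ℝ :=
  -fderiv ℝ (fderiv ℝ Φ) y (E4.basisVector 0) (E4.basisVector 0) +
    fderiv ℝ (fderiv ℝ Φ) y (E4.basisVector 1) (E4.basisVector 1) +
    fderiv ℝ (fderiv ℝ Φ) y (E4.basisVector 2) (E4.basisVector 2) +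
    fderiv ℝ (fderiv ℝ Φ) y (E4.basisVector 3) (E4.basisVector 3)

/-- The `M = 0` bracket of the coordinate form is the flat wave operator. [folklore] -/
theorem sum_inverseMetric_zero_mass (a : ℝ) (Φ : E4 → ℝ) (y : E4) :
    (∑ μ, ∑ ν, inverseMetric 0 a y μ ν *
        fderiv ℝ (fderiv ℝ Φ) y (E4.basisVector μ) (E4.basisVector ν) +
      ∑ ν, divInverseMetric 0 a y ν * fderiv ℝ Φ y (E4.basisVector ν)) = flatBox Φ y := by
  simp only [inverseMetric_zero_mass, divInverseMetric_zero_mass, zero_mul,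
    Finset.sum_const_zero, add_zero, Fin.sum_univ_four, Fin.isValue, flatBox]
  simp

/-- Continuity of the flat wave operator of a `C²` function. [folklore] -/
theorem continuous_flatBox {Φ : E4 → ℝ} (hΦ : ContDiff ℝ 2 Φ) : Continuous (flatBox Φ) := by
  have h2 : Continuous (fderiv ℝ (fderiv ℝ Φ)) :=
    (hΦ.fderiv_right (m := 1) (by norm_num)).continuous_fderiv one_ne_zero
  have hc : ∀ u v : E4, Continuous fun y ↦ fderiv ℝ (fderiv ℝ Φ) y u v := fun u v ↦
    (ContinuousLinearMap.apply ℝ ℝ v).continuous.comp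
      ((ContinuousLinearMap.apply ℝ (E4 →L[ℝ] ℝ) u).continuous.comp h2)
  unfold flatBox
  exact (((hc _ _).neg.add (hc _ _)).add (hc _ _)).add (hc _ _)

/-! ### The angular Laplacian of the pull-back, continuously across the poles -/

/-- **The angular Laplacian `Δ̸_{(θ,φ*)} F`, `F = Φ ∘ κ_a`, as a function of `q`**:
`Σ · (□_η Φ)(κ q) + Σ ∂₀∂₀F - (r² + a²) ∂₁∂₁F - 2r ∂₁F - 2a ∂₁∂₃F`, `Σ = r² + a² cos²θ` — which
equals `∂₂∂₂F + cot θ ∂₂F + sin⁻²θ ∂₃∂₃F` off the poles (`sphLaplacianStar_eq`) and is continuous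
everywhere. [folklore] -/
def sphLaplacianStar (a : ℝ) (Φ : E4 → ℝ) (q : E4) : ℝ :=
  (q 1 ^ 2 + a ^ 2 * cos (q 2) ^ 2) * flatBox Φ (starChart a q) +
    (q 1 ^ 2 + a ^ 2 * cos (q 2) ^ 2) *
      fderiv ℝ (fderiv ℝ (starPull a Φ)) q (E4.basisVector 0) (E4.basisVector 0) -
    (q 1 ^ 2 + a ^ 2) * fderiv ℝ (fderiv ℝ (starPull a Φ)) q (E4.basisVector 1) (E4.basisVector 1) -
    2 * q 1 * fderiv ℝ (starPull a Φ) q (E4.basisVector 1) -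
    2 * a * fderiv ℝ (fderiv ℝ (starPull a Φ)) q (E4.basisVector 1) (E4.basisVector 3)

/-- **Off the poles `sphLaplacianStar` is the angular Laplacian**:
`= ∂₂∂₂F + (cos θ / sin θ) ∂₂F + (sin²θ)⁻¹ ∂₃∂₃F` for `r > 0`, `sin θ ≠ 0`, `Φ ∈ C²` at `κ q`
(the `M = 0` case of `Kerr.blSigma_mul_coordWave_starChart`). [cite: Aretakis2012, §2.4] -/
theorem sphLaplacianStar_eq {a : ℝ} {Φ : E4 → ℝ} {q : E4} (hr : 0 < q 1) (hθ : sin (q 2) ≠ 0)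
    (hΦ : ContDiffAt ℝ 2 Φ (starChart a q)) :
    sphLaplacianStar a Φ q =
      fderiv ℝ (fderiv ℝ (starPull a Φ)) q (E4.basisVector 2) (E4.basisVector 2) +
        cos (q 2) / sin (q 2) * fderiv ℝ (starPull a Φ) q (E4.basisVector 2) +
        (sin (q 2) ^ 2)⁻¹ *
          fderiv ℝ (fderiv ℝ (starPull a Φ)) q (E4.basisVector 3) (E4.basisVector 3) := by
  have h := blSigma_mul_coordWave_starChart (M := 0) (a := a) hr hθ hΦ
  rw [sum_inverseMetric_zero_mass] at h
  rw [sphLaplacianStar]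
  linear_combination h

/-- Continuity of `sphLaplacianStar a Φ` for `Φ ∈ C²(ℝ⁴)`. [folklore] -/
theorem continuous_sphLaplacianStar (a : ℝ) {Φ : E4 → ℝ} (hΦ : ContDiff ℝ 2 Φ) :
    Continuous (sphLaplacianStar a Φ) := by
  have hF : ContDiff ℝ 2 (starPull a Φ) := hΦ.comp (contDiff_starChart a)
  have h2 : Continuous (fderiv ℝ (fderiv ℝ (starPull a Φ))) :=
    (hF.fderiv_right (m := 1) (by norm_num)).continuous_fderiv one_ne_zero
  have hc2 : ∀ u v : E4, Continuous fun y ↦ fderiv ℝ (fderiv ℝ (starPull a Φ)) y u v := fun u v ↦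
    (ContinuousLinearMap.apply ℝ ℝ v).continuous.comp
      ((ContinuousLinearMap.apply ℝ (E4 →L[ℝ] ℝ) u).continuous.comp h2)
  have hc1 : ∀ v : E4, Continuous fun y ↦ fderiv ℝ (starPull a Φ) y v := fun v ↦
    (ContinuousLinearMap.apply ℝ ℝ v).continuous.comp (hF.continuous_fderiv two_ne_zero)
  have hq1 : Continuous fun q : E4 ↦ q 1 := PiLp.continuous_apply 2 _ 1
  have hq2 : Continuous fun q : E4 ↦ q 2 := PiLp.continuous_apply 2 _ 2
  unfold sphLaplacianStar
  have hSig : Continuous fun q : E4 ↦ q 1 ^ 2 + a ^ 2 * cos (q 2) ^ 2 := by fun_prop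
  exact ((((hSig.mul ((continuous_flatBox hΦ).comp (contDiff_starChart a (n := 2)).continuous)).add
    (hSig.mul (hc2 _ _))).sub ((by fun_prop : Continuous fun q : E4 ↦ q 1 ^ 2 + a ^ 2).mul
      (hc2 _ _))).sub ((by fun_prop : Continuous fun q : E4 ↦ 2 * q 1).mul (hc1 _))).sub
    (continuous_const.mul (hc2 _ _))

/-! ### The slices at fixed `(t*, r)` and the pairing with the oblate spheroidal harmonics -/

section Slices

variable (a : ℝ) (Φ : E4 → ℝ) (t r : ℝ)

/-- **The slice `g(θ, φ) = F(t*, r, θ, φ)`** of `F = Φ ∘ κ_a`, as a complex function. [folklore] -/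
def sliceFn (θ φ : ℝ) : ℂ := (starPull a Φ (starq t r θ φ) : ℂ)

/-- **The slice of the angular Laplacian** `Δ̸F(t*, r, θ, φ)`. [folklore] -/
def sliceLap (θ φ : ℝ) : ℂ := (sphLaplacianStar a Φ (starq t r θ φ) : ℂ)

/-- Unfolding. [folklore] -/
theorem sliceFn_apply (θ φ : ℝ) : sliceFn a Φ t r θ φ = (starPull a Φ (starq t r θ φ) : ℂ) := rfl

/-- Unfolding. [folklore] -/
theorem sliceLap_apply (θ φ : ℝ) :
    sliceLap a Φ t r θ φ = (sphLaplacianStar a Φ (starq t r θ φ) : ℂ) := rfl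

variable {Φ}

/-- Continuity of the slice. [folklore] -/
theorem continuous_sliceFn (hΦ : ContDiff ℝ 2 Φ) :
    Continuous (Function.uncurry (sliceFn a Φ t r)) :=
  Complex.continuous_ofReal.comp
    (continuous_comp_starq (hΦ.comp (contDiff_starChart a)).continuous t r)

/-- Continuity of the Laplacian slice. [folklore] -/
theorem continuous_sliceLap (hΦ : ContDiff ℝ 2 Φ) :
    Continuous (Function.uncurry (sliceLap a Φ t r)) :=
  Complex.continuous_ofReal.comp ((continuous_sphLaplacianStar a hΦ).comp (continuous_starq t r))

end Slices

/-- Negation commutes with the polar pull-back. [folklore] -/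
theorem polarLp_neg {T : ℝ} [Fact (0 < T)] (g : ℝ → ℝ → ℂ) (hg : Continuous (Function.uncurry g))
    (hn : Continuous (Function.uncurry fun θ φ ↦ -g θ φ)) :
    polarLp T (fun θ φ ↦ -g θ φ) hn = -polarLp T g hg := by
  refine Lp.ext ?_
  filter_upwards [coeFn_polarLp T (fun θ φ ↦ -g θ φ) hn, coeFn_polarLp T g hg,
    Lp.coeFn_neg (polarLp T g hg)] with z h1 h2 h3
  rw [h1, h3, Pi.neg_apply, h2]
  rfl

section Main

variable [h2π : Fact (0 < 2 * π)]

/-- **The angular half of Carter's separation** (DRSR Prop. 5.2.1): for `Φ ∈ C²(ℝ⁴)`, `r > 0`,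
real `ν` and every index `q` of the oblate spheroidal Hilbert basis
`Ψ_q = oblateSphereBasis (2π) ν q` of `L²([-1,1] × 𝕋)`,
`⟪Ψ_q, 𝓛(Δ̸F|_{t*,r})⟫ = -λ_q(ν) ⟪Ψ_q, 𝓛(F|_{t*,r})⟫ - ν² ⟪Ψ_q, x² · 𝓛(F|_{t*,r})⟫`
(`Δ̸ = ∂_θ² + cot θ ∂_θ + sin⁻²θ ∂_φ²` the angular part of `ρ²□_g` in `(t*, r, θ, φ*)`,
`x = cos θ`). [cite: DafermosRodnianskiShlapentokhrothman2014, §5.2.3 Prop. 5.2.1] -/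
theorem inner_oblateSphereBasis_sliceLap (a : ℝ) {Φ : E4 → ℝ} (hΦ : ContDiff ℝ 2 Φ) {t r : ℝ}
    (hr : 0 < r) (ν : ℝ) (p : OblateSphereIndex ν) :
    ⟪oblateSphereBasis (2 * π) ν p,
        polarLp (2 * π) (sliceLap a Φ t r) (continuous_sliceLap a t r hΦ)⟫_ℂ =
      -(oblateSphereEig ν p : ℂ) *
          ⟪oblateSphereBasis (2 * π) ν p,
            polarLp (2 * π) (sliceFn a Φ t r) (continuous_sliceFn a t r hΦ)⟫_ℂ -
        ((ν ^ 2 : ℝ) : ℂ) *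
          ⟪oblateSphereBasis (2 * π) ν p, mulSqFst (2 * π)
            (polarLp (2 * π) (sliceFn a Φ t r) (continuous_sliceFn a t r hΦ))⟫_ℂ := by
  set F : E4 → ℝ := starPull a Φ with hFdef
  have hF : ContDiff ℝ 2 F := hΦ.comp (contDiff_starChart a)
  have hFd : ∀ q, DifferentiableAt ℝ F q := fun q ↦ hF.differentiable two_ne_zero q
  -- the data of `oblateSphere_weak_polar`
  set e₂ : E4 := E4.basisVector 2
  set e₃ : E4 := E4.basisVector 3
  set g : ℝ → ℝ → ℂ := sliceFn a Φ t r with hgdef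
  set gθ : ℝ → ℝ → ℂ := fun θ φ ↦ (fderiv ℝ F (starq t r θ φ) e₂ : ℂ) with hgθdef
  set w : ℝ → ℝ → ℂ := fun θ φ ↦ ((cos θ * fderiv ℝ F (starq t r θ φ) e₂ +
    sin θ * fderiv ℝ (fderiv ℝ F) (starq t r θ φ) e₂ e₂ : ℝ) : ℂ) with hwdef
  set gφ : ℝ → ℝ → ℂ := fun θ φ ↦ (fderiv ℝ F (starq t r θ φ) e₃ : ℂ) with hgφdef
  set gφφ : ℝ → ℝ → ℂ := fun θ φ ↦ (fderiv ℝ (fderiv ℝ F) (starq t r θ φ) e₃ e₃ : ℂ) with hgφφdef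
  set h : ℝ → ℝ → ℂ := fun θ φ ↦ -sliceLap a Φ t r θ φ with hhdef
  have hgθ : ∀ θ φ, HasDerivAt (fun θ ↦ g θ φ) (gθ θ φ) θ := fun θ φ ↦
    (hasDerivAt_comp_starq_theta t r θ φ (hFd _)).ofReal_comp
  have hw : ∀ θ φ, HasDerivAt (fun θ ↦ (sin θ : ℂ) * gθ θ φ) (w θ φ) θ := by
    intro θ φ
    have h1 := (hasDerivAt_sin θ).mul (hasDerivAt_fderiv_comp_starq_theta hF t r θ φ e₂)
    have h2 := h1.ofReal_comp
    have hfun : (fun θ ↦ (sin θ : ℂ) * gθ θ φ) =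
        fun y ↦ ((sin y * fderiv ℝ F (starq t r y φ) e₂ : ℝ) : ℂ) := by
      funext y
      rw [hgθdef]
      push_cast
      ring
    rw [hfun]
    refine h2.congr_deriv ?_
    rw [hwdef]
  have hgφ : ∀ θ φ, HasDerivAt (g θ) (gφ θ φ) φ := fun θ φ ↦
    (hasDerivAt_comp_starq_phi t r θ φ (hFd _)).ofReal_comp
  have hgφφ : ∀ θ φ, HasDerivAt (gφ θ) (gφφ θ φ) φ := fun θ φ ↦
    (hasDerivAt_fderiv_comp_starq_phi hF t r θ φ e₃).ofReal_comp
  have hcg : Continuous (Function.uncurry g) := continuous_sliceFn a t r hΦ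
  have hcgθ : Continuous (Function.uncurry gθ) :=
    Complex.continuous_ofReal.comp (continuous_fderiv_comp_starq hF two_ne_zero t r e₂)
  have hcw : Continuous (Function.uncurry w) := by
    refine Complex.continuous_ofReal.comp ?_
    exact ((continuous_cos.comp continuous_fst).mul
      (continuous_fderiv_comp_starq hF two_ne_zero t r e₂)).add
      ((continuous_sin.comp continuous_fst).mul (continuous_fderiv_fderiv_comp_starq hF t r e₂ e₂))
  have hcgφφ : Continuous (Function.uncurry gφφ) :=
    Complex.continuous_ofReal.comp (continuous_fderiv_fderiv_comp_starq hF t r e₃ e₃)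
  have hch : Continuous (Function.uncurry h) := (continuous_sliceLap a t r hΦ).neg
  have hper : ∀ θ φ, g θ (φ + 2 * π) = g θ φ := by
    intro θ φ
    rw [hgdef, sliceFn_apply, sliceFn_apply, starq_add_phi, starPull_add_two_pi]
  have hperφ : ∀ θ φ, gφ θ (φ + 2 * π) = gφ θ φ := by
    intro θ φ
    simp only [hgφdef]
    rw [starq_add_phi, hFdef, fderiv_starPull_add_two_pi]
  have hrel : ∀ θ φ, (sin θ : ℂ) ^ 2 * h θ φ = -(sin θ : ℂ) * w θ φ - gφφ θ φ := by
    intro θ φ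
    by_cases hs : sin θ = 0
    · -- at the poles everything vanishes: `∂₃F = ∂₃∂₃F = 0` there
      have hconst : ∀ φ', F (starq t r θ φ') = F (starq t r θ 0) := fun φ' ↦ by
        rw [hFdef, starPull_apply, starPull_apply, starChart_starq_of_sin_eq_zero a hs φ',
          starChart_starq_of_sin_eq_zero a hs 0]
      have h3 : ∀ φ', fderiv ℝ F (starq t r θ φ') e₃ = 0 := fun φ' ↦ by
        have hd := hasDerivAt_comp_starq_phi t r θ φ' (hFd _)
        have hc : HasDerivAt (fun φ'' ↦ F (starq t r θ φ'')) 0 φ' := by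
          have : (fun φ'' ↦ F (starq t r θ φ'')) = fun _ ↦ F (starq t r θ 0) := funext hconst
          rw [this]
          exact hasDerivAt_const _ _
        exact hd.unique hc
      have h33 : fderiv ℝ (fderiv ℝ F) (starq t r θ φ) e₃ e₃ = 0 := by
        have hd := hasDerivAt_fderiv_comp_starq_phi hF t r θ φ e₃
        have hc : HasDerivAt (fun φ' ↦ fderiv ℝ F (starq t r θ φ') e₃) 0 φ := by
          have : (fun φ' ↦ fderiv ℝ F (starq t r θ φ') e₃) = fun _ ↦ (0 : ℝ) := funext h3
          rw [this]
          exact hasDerivAt_const _ _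
        exact hd.unique hc
      rw [hgφφdef]
      simp only [hs, h33, Complex.ofReal_zero]
      ring
    · have hq1 : 0 < starq t r θ φ 1 := by rwa [starq_apply_one]
      have hq2 : sin (starq t r θ φ 2) ≠ 0 := by rwa [starq_apply_two]
      have hreal : sin θ ^ 2 * (-sphLaplacianStar a Φ (starq t r θ φ)) =
          -sin θ * (cos θ * fderiv ℝ F (starq t r θ φ) e₂ +
            sin θ * fderiv ℝ (fderiv ℝ F) (starq t r θ φ) e₂ e₂) -
            fderiv ℝ (fderiv ℝ F) (starq t r θ φ) e₃ e₃ := by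
        rw [sphLaplacianStar_eq hq1 hq2 hΦ.contDiffAt, starq_apply_two]
        field_simp
        ring
      rw [hhdef, hwdef, hgφφdef]
      simp only [sliceLap_apply]
      exact_mod_cast hreal
  have weak := oblateSphere_weak_polar ν p hgθ hw hgφ hgφφ hcg hcgθ hcw hcgφφ hch hper hperφ hrel
  rw [show polarLp (2 * π) h hch =
      -polarLp (2 * π) (sliceLap a Φ t r) (continuous_sliceLap a t r hΦ)
    from polarLp_neg _ (continuous_sliceLap a t r hΦ) hch, inner_neg_right] at weak
  linear_combination -weak

end Main

end Kerr

end Literature.Geometry.Lorentzian
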